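import Mathlib.Algebra.Group.TypeTags.Finite
import Mathlib.Data.ZMod.Basic
import Literature.AnabelianGeometry.AbsoluteAnabelian.AbsTopII.DecompositionGroups

/-!
# [AbsTopII] Prop 1.3 (iii), (iv), (ix) and `Adjacent` as typed over `DPSCData`: the SCHEMA SCOPE
# — kernel certificates (FACT-LIST F-0274 / F-0275 / F-0276 / F-0277)

S. Mochizuki, *Topics in Absolute Anabelian Geometry II* [AbsTopII] (bib `MochizukiAbsTopII2013`;
locators = PDF pages of the kurims manuscript `paper:url-585b8d0ad0d9`), §1, Def 1.2 (ii) p. 10,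
Prop 1.3 (iii), (iv), (ix) pp. 11–12.

abc-iut-L4-t4 typed Prop 1.3 over the ABSTRACT data structure `DPSCData` (a profinite `Π_H`, normal
subgroups `Π_𝔾 ≤ Π_I`, labels `Vert`/`Node`/`Cusp` with chosen subgroups and an incidence relation —
no axiom tying the data to a stable log curve) as the PREDICATES `DPSCData.Prop13iii` (F-0275),
`DPSCData.Prop13iv` (F-0276; superseded by `Prop13iv'`, finding F-L4t6g5-1), `DPSCData.Prop13ix`
(F-0277), with the auxiliary two-place predicate `DPSCData.Adjacent` (F-0274): "the printed
conclusions; they hold for data arising from a stable log curve — the model-relative comparison is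
not asserted here" (file docstring of `AbsTopII/DecompositionGroups.lean`).  This PROOF-ONLY file
(no definitions, no named facts) records as KERNEL CERTIFICATES what that sentence means for the
frozen FACT-LIST rows (plan R5, "schema over interface fields: universal closure is not a fact;
named instances only"):

* `exists_countermodel` — ONE explicit finite datum (`Π_H = Π_I = Π_𝔾 = ℤ/2` discrete, `Π_v = 1`,
  two vertex labels, one node, one cusp) at which `I_v ∩ Π_𝔾 ≠ 1`, `D_v ∩ D_{v'} ∩ Π_I ≠ 1` and
  `I_v ∩ I_{v'} ≠ 1` for two labels `v ≠ v'` that are neither adjacent nor at distance two, and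
  `D_e` is open; hence the UNIVERSAL CLOSURES of the four predicates are REFUTED:
  `not_forall_prop13iii`, `not_forall_prop13iv` (each conjunct separately:
  `not_forall_prop13iv_trichotomy`, `not_forall_prop13iv_inertia`; likewise for the repaired
  `Prop13iv'`: `not_forall_prop13iv'`), `not_forall_prop13ix` (node and cusp clause separately),
  `not_forall_adjacent`.  For (iv) this makes abc-iut-L4-t6's conditional conjugacy-scope
  certificates (`AbsTopII/Prop13ConjugacyScope.lean`: `not_prop13iv_of_vertSub_moved`, …)
  unconditional at the level of the universal closure.
* `exists_model` — ONE explicit datum (`Π_H = Π_I = ℤ/2`, `Π_𝔾 = Π_v = 1`, one vertex, no edges: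
  "a smooth proper curve with one component over a log point with inertia `ℤ/2`") at which
  `Prop13iii`, `Prop13iv`, `Prop13iv'`, `Prop13ix` all HOLD ((ix) vacuously: no edges) and no two
  vertices are adjacent: the predicates are CONSISTENT, so the refutations above are about the
  missing geometric inputs, not about an internal contradiction, and `Adjacent` is genuine
  VOCABULARY (neither valid nor contradictory: `not_forall_adjacent`, `exists_adjacent`).

INSTANCE FORMS OF RECORD (the shape in which the cone may consume these rows, all landed, cited by
name, not restated): `DPSCData.prop13iii_of_inputs` (`AbsTopII/InertiaDecompositionProducts.lean`:
(iii) from slimness + commensurable terminality of `Π_v` and the surjectivity `I_v·Π_𝔾 = Π_I`),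
`DPSCData.prop13ix_of_inputs` / `DPSCIndexData.prop13ix_of_prop_1_3_i_ii`
(`AbsTopII/InertiaDecompositionOpenness.lean`: (ix) from [CombGC] Prop 1.2 (ii), slimness and
nontriviality of `Π_𝔾`, `Π_e` abelian, and the printed first halves), and for (iv) the bridge
`DPSCData.prop13iv_iff_prop13iv'_of_PiI_eq_top` (`AbsTopII/DecompositionGroupsProp13ivBridge.lean`).
No `DPSCData` term modelling an actual stable log curve exists in the tree (the TODO-merge with
abc-iut-L3's PSC-fundamental groups is recorded in the trunk file), so no closed instance is
consumable today.

HONEST FRAMING: statements about OUR abstract typing only — [AbsTopII] Prop 1.3 is a refereed,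
undisputed result about data ARISING FROM A STABLE LOG CURVE, which the countermodel is not; nothing
here bears on the truth of Prop 1.3, on any author, or on [IUTchIII] Cor 3.12.  A FACT row is an
assumption label, not an endorsement; refuted = OUR kernel check of the closure of OUR predicate.
-/

open scoped Pointwise

namespace Literature.AnabelianGeometry.AbsoluteAnabelian

universe u

/-! ## Two lattice computations valid in every group -/

section GroupTheory

variable {G : Type u} [Group G]

/-- `Z_G(1) = G`. [folklore] -/
private theorem centralizer_coe_bot_eq_top :
    Subgroup.centralizer ((⊥ : Subgroup G) : Set G) = ⊤ := by
  rw [Subgroup.centralizer_eq_top_iff_subset, Subgroup.coe_bot, Set.singleton_subset_iff]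
  exact (Subgroup.center G).one_mem

/-- `N_G(1) = G`. [folklore] -/
private theorem normalizer_coe_bot_eq_top :
    Subgroup.normalizer ((⊥ : Subgroup G) : Set G) = ⊤ :=
  Subgroup.normalizer_eq_top ⊥

end GroupTheory

/-! ## The finite discrete profinite group `ℤ/2` (in universe `u`) -/

/-- The witness group `ℤ/2` (discrete) is nontrivial. [folklore] -/
private theorem nontrivial_witnessGrp :
    Nontrivial ↥(ProfiniteGrp.ofFiniteGrp (FiniteGrp.of (ULift.{u} (Multiplicative (ZMod 2))))) :=
  inferInstanceAs (Nontrivial (ULift.{u} (Multiplicative (ZMod 2))))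

/-- The witness group `ℤ/2` carries the discrete topology. [folklore] -/
private theorem discreteTopology_witnessGrp :
    DiscreteTopology ↥(ProfiniteGrp.ofFiniteGrp (FiniteGrp.of (ULift.{u} (Multiplicative (ZMod 2))))) :=
  ⟨rfl⟩

namespace DPSCData

variable (X : DPSCData.{u})

/-! ## Degenerate data: `Π_v = 1` -/

/-- If `Π_v = 1` then `D_v = N_{Π_H}(1) = Π_H`. [cite: MochizukiAbsTopII2013, Def 1.2 (ii) p.10] -/
theorem Dv_eq_top_of_vertSub_eq_bot {v : X.Vert} (hv : X.vertSub v = ⊥) : X.Dv v = ⊤ := by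
  unfold DPSCData.Dv
  rw [hv, normalizer_coe_bot_eq_top]

/-- If `Π_v = 1` then `I_v = Z_{Π_I}(1) = Π_I`. [cite: MochizukiAbsTopII2013, Def 1.2 (ii) p.10] -/
theorem Iv_eq_PiI_of_vertSub_eq_bot {v : X.Vert} (hv : X.vertSub v = ⊥) : X.Iv v = X.PiI := by
  unfold DPSCData.Iv
  rw [hv, centralizer_coe_bot_eq_top, top_inf_eq]

/-- The bad conclusions at ANY datum of the countermodel's shape: `Π_𝔾 = Π_I = Π_H` nontrivial and
discrete, all `Π_v = 1`, two vertex labels `v₀ ≠ v₁` neither adjacent nor at distance two, a node,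
a cusp, and a self-adjacent vertex. [cite: MochizukiAbsTopII2013, Prop 1.3 (iii) p.11] -/
private theorem countermodel_of (hN : Nontrivial X.PiH) (hT : DiscreteTopology X.PiH)
    (hG : X.PiG = ⊤) (hI : X.PiI = ⊤) (hv : ∀ v : X.Vert, X.vertSub v = ⊥)
    (v₀ v₁ : X.Vert) (hne : v₀ ≠ v₁) (hnadj : ¬ X.Adjacent v₀ v₁)
    (hfar : ¬ ∃ v'' : X.Vert, v'' ≠ v₀ ∧ v'' ≠ v₁ ∧ X.Adjacent v₀ v'' ∧ X.Adjacent v'' v₁)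
    (e : X.Node) (c : X.Cusp) (hadj : X.Adjacent v₁ v₁) :
    (∃ v : X.Vert, X.Iv v ⊓ X.PiG ≠ ⊥) ∧
    (∃ v v' : X.Vert, v ≠ v' ∧ ¬ X.Adjacent v v' ∧
      (¬ ∃ v'' : X.Vert, v'' ≠ v ∧ v'' ≠ v' ∧ X.Adjacent v v'' ∧ X.Adjacent v'' v') ∧
      X.Dv v ⊓ MulAut.conj (1 : X.PiH) • X.Dv v' ⊓ X.PiI ≠ ⊥ ∧
      X.Iv v ⊓ MulAut.conj (1 : X.PiH) • X.Iv v' ≠ ⊥) ∧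
    (∃ e : X.Node, IsOpen (X.DvNode e : Set X.PiH)) ∧
    (∃ e : X.Cusp, IsOpen (X.DvCusp e : Set X.PiH)) ∧
    (∃ v v' : X.Vert, X.Adjacent v v') := by
  haveI := hN
  haveI := hT
  have hIv : ∀ v : X.Vert, X.Iv v = ⊤ := fun v => (X.Iv_eq_PiI_of_vertSub_eq_bot (hv v)).trans hI
  have hDv : ∀ v : X.Vert, X.Dv v = ⊤ := fun v => X.Dv_eq_top_of_vertSub_eq_bot (hv v)
  refine ⟨⟨v₀, ?_⟩, ⟨v₀, v₁, hne, hnadj, hfar, ?_, ?_⟩, ⟨e, isOpen_discrete _⟩,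
    ⟨c, isOpen_discrete _⟩, ⟨v₁, v₁, hadj⟩⟩
  · rw [hIv, hG, inf_idem]
    exact top_ne_bot
  · rw [map_one, one_smul, hDv, hDv, hI, inf_idem, inf_idem]
    exact top_ne_bot
  · rw [map_one, one_smul, hIv, hIv, inf_idem]
    exact top_ne_bot

/-! ## The countermodel and the refutations of the universal closures -/

/-- **Countermodel (WITNESS DATA, not a model of any curve).** There is a DPSC datum — `Π_H = Π_I =
Π_𝔾 = ℤ/2` (discrete), every `Π_v = 1` (so `I_v = Z_{Π_I}(Π_v) = Π_I` and `D_v = Π_H`), two vertex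
labels `v₀ ≠ v₁`, one node and one cusp abutting to `v₁` only — at which: some `I_v ∩ Π_𝔾 ≠ {1}`
(against (iii) "`I_v ↪ I`"); for the NON-adjacent labels `v₀ ≠ v₁` with no third vertex at all,
`D_{v₀} ∩ D_{v₁} ∩ Π_I ≠ {1}` and `I_{v₀} ∩ I_{v₁} ≠ {1}` (against both clauses of (iv), the
conjugating element being `1 ∈ Π_𝔾`); `D_e` is open in `Π_H` for the node and for the cusp (against
(ix)); and `v₁` is adjacent to itself. [cite: MochizukiAbsTopII2013, Prop 1.3 (iii) p.11] -/
theorem exists_countermodel : ∃ X : DPSCData.{u},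
    (∃ v : X.Vert, X.Iv v ⊓ X.PiG ≠ ⊥) ∧
    (∃ v v' : X.Vert, v ≠ v' ∧ ¬ X.Adjacent v v' ∧
      (¬ ∃ v'' : X.Vert, v'' ≠ v ∧ v'' ≠ v' ∧ X.Adjacent v v'' ∧ X.Adjacent v'' v') ∧
      X.Dv v ⊓ MulAut.conj (1 : X.PiH) • X.Dv v' ⊓ X.PiI ≠ ⊥ ∧
      X.Iv v ⊓ MulAut.conj (1 : X.PiH) • X.Iv v' ≠ ⊥) ∧
    (∃ e : X.Node, IsOpen (X.DvNode e : Set X.PiH)) ∧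
    (∃ e : X.Cusp, IsOpen (X.DvCusp e : Set X.PiH)) ∧
    (∃ v v' : X.Vert, X.Adjacent v v') := by
  haveI := discreteTopology_witnessGrp.{u}
  refine ⟨_, countermodel_of
    { PiH := ProfiniteGrp.ofFiniteGrp (FiniteGrp.of (ULift.{u} (Multiplicative (ZMod 2))))
      PiG := ⊤
      normal_PiG := inferInstance
      isClosed_PiG := isClosed_discrete _
      PiI := ⊤
      PiG_le_PiI := le_rfl
      normal_PiI := inferInstance
      Vert := ULift.{u} Bool
      Node := PUnit.{u + 1}
      Cusp := PUnit.{u + 1}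
      vertSub := fun _ => ⊥
      vertSub_le := fun _ => bot_le
      nodeSub := fun _ => ⊥
      nodeSub_le := fun _ => bot_le
      cuspSub := fun _ => ⊥
      cuspSub_le := fun _ => bot_le
      nodeAbuts := fun _ v => v.down = true
      cuspVert := fun _ => ULift.up true }
    nontrivial_witnessGrp.{u} discreteTopology_witnessGrp.{u} rfl rfl (fun _ => rfl)
    (ULift.up false) (ULift.up true) (fun h => Bool.false_ne_true (congrArg ULift.down h))
    ?_ ?_ PUnit.unit PUnit.unit ⟨PUnit.unit, rfl, rfl⟩⟩
  · -- `v₀ = false` and `v₁ = true` are not adjacent: the node abuts to `true` only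
    rintro ⟨_, h, -⟩
    exact Bool.false_ne_true h
  · -- and there is no third vertex label
    rintro ⟨⟨_ | _⟩, h0, h1, -, -⟩
    · exact h0 rfl
    · exact h1 rfl

/-- **F-0275: the universal closure of `DPSCData.Prop13iii` is REFUTED** ("`I_v ≅ I`", i.e.
`I_v ∩ Π_𝔾 = 1 ∧ I_v·Π_𝔾 = Π_I`, fails at the countermodel: `I_v ∩ Π_𝔾 = ℤ/2`).  Instance form of
record: `DPSCData.prop13iii_of_inputs`. [cite: MochizukiAbsTopII2013, Prop 1.3 (iii) p.11] -/
theorem not_forall_prop13iii : ¬ ∀ X : DPSCData.{u}, X.Prop13iii := by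
  intro h
  obtain ⟨X, ⟨v, hv⟩, -⟩ := exists_countermodel.{u}
  exact hv (h X v).1

/-- **F-0276, first clause: the universal closure of the TRICHOTOMY conjunct of `DPSCData.Prop13iv`
is REFUTED** — at the countermodel `D_{v₀} ∩ 1·D_{v₁}·1⁻¹ ∩ Π_I ≠ {1}` for two labels that are
neither equal, nor adjacent, nor at distance two. [cite: MochizukiAbsTopII2013, Prop 1.3 (iv) p.11] -/
theorem not_forall_prop13iv_trichotomy : ¬ ∀ X : DPSCData.{u},
    ∀ (v v' : X.Vert) (g : X.PiH), X.Dv v ⊓ MulAut.conj g • X.Dv v' ⊓ X.PiI ≠ ⊥ →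
      v = v' ∨ (v ≠ v' ∧ X.Adjacent v v') ∨
        (v ≠ v' ∧ ¬ X.Adjacent v v' ∧ ∃ v'' : X.Vert, v'' ≠ v ∧ v'' ≠ v' ∧
          X.Adjacent v v'' ∧ X.Adjacent v'' v') := by
  intro h
  obtain ⟨X, -, ⟨v, v', hne, hnadj, hfar, hD, -⟩, -⟩ := exists_countermodel.{u}
  rcases h X v v' 1 hD with h1 | ⟨-, h2⟩ | ⟨-, -, h3⟩
  · exact hne h1
  · exact hnadj h2
  · exact hfar h3

/-- **F-0276, "in particular" clause: the universal closure of the INERTIA conjunct of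
`DPSCData.Prop13iv` is REFUTED** — at the countermodel `I_{v₀} ∩ 1·I_{v₁}·1⁻¹ = ℤ/2 ≠ {1}` with
`v₀ ≠ v₁`. [cite: MochizukiAbsTopII2013, Prop 1.3 (iv) p.12] -/
theorem not_forall_prop13iv_inertia : ¬ ∀ X : DPSCData.{u},
    ∀ (v v' : X.Vert) (g : X.PiH), X.Iv v ⊓ MulAut.conj g • X.Iv v' ≠ ⊥ → v = v' := by
  intro h
  obtain ⟨X, -, ⟨v, v', hne, -, -, -, hI⟩, -⟩ := exists_countermodel.{u}
  exact hne (h X v v' 1 hI)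

/-- **F-0276: the universal closure of `DPSCData.Prop13iv` (SUPERSEDED typing, conjugating element
over `Π_H`) is REFUTED** unconditionally — sharpening abc-iut-L4-t6's conditional certificates
`not_prop13iv_of_vertSub_moved` / `not_prop13iv_of_far_vertSub_moved` (there: given a vertex-moving
`g`; here: an explicit datum, `g = 1`).  Instance form of record: the bridge
`DPSCData.prop13iv_iff_prop13iv'_of_PiI_eq_top`. [cite: MochizukiAbsTopII2013, Prop 1.3 (iv) p.11] -/
theorem not_forall_prop13iv : ¬ ∀ X : DPSCData.{u}, X.Prop13iv :=
  fun h => not_forall_prop13iv_inertia.{u} fun X => (h X).2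

/-- The universal closure of the REPAIRED typing `DPSCData.Prop13iv'` (conjugating element
`γ ∈ Π_𝔾`, the printed conjugacy scope) is refuted by the same datum (`γ = 1 ∈ Π_𝔾`): over abstract
`DPSCData` the printed form, too, is a SCHEMA whose instances need the geometric inputs ([CombGC]
Prop 1.2 (i)(ii), graphicity), not a closed fact. [cite: MochizukiAbsTopII2013, Prop 1.3 (iv) p.11] -/
theorem not_forall_prop13iv' : ¬ ∀ X : DPSCData.{u}, X.Prop13iv' := by
  intro h
  obtain ⟨X, -, ⟨v, v', hne, -, -, -, hI⟩, -⟩ := exists_countermodel.{u}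
  exact hne ((h X).2 v v' 1 X.PiG.one_mem hI)

/-- **F-0277, node clause: the universal closure of "`D_e` is not open in `Π_H`" is REFUTED** — in
the finite discrete countermodel every subgroup is open. [cite: MochizukiAbsTopII2013, Prop 1.3 (ix) p.12] -/
theorem not_forall_not_isOpen_DvNode : ¬ ∀ X : DPSCData.{u},
    ∀ e : X.Node, ¬ IsOpen (X.DvNode e : Set X.PiH) := by
  intro h
  obtain ⟨X, -, -, ⟨e, he⟩, -⟩ := exists_countermodel.{u}
  exact h X e he

/-- **F-0277, cusp clause: the universal closure of "`D_e` is not open in `Π_H`" (cusps) is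
REFUTED.** [cite: MochizukiAbsTopII2013, Prop 1.3 (ix) p.12] -/
theorem not_forall_not_isOpen_DvCusp : ¬ ∀ X : DPSCData.{u},
    ∀ e : X.Cusp, ¬ IsOpen (X.DvCusp e : Set X.PiH) := by
  intro h
  obtain ⟨X, -, -, -, ⟨e, he⟩, -⟩ := exists_countermodel.{u}
  exact h X e he

/-- **F-0277: the universal closure of `DPSCData.Prop13ix` is REFUTED.**  Instance forms of record:
`DPSCData.prop13ix_of_inputs`, `DPSCIndexData.prop13ix_of_prop_1_3_i_ii`.
[cite: MochizukiAbsTopII2013, Prop 1.3 (ix) p.12] -/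
theorem not_forall_prop13ix : ¬ ∀ X : DPSCData.{u}, X.Prop13ix :=
  fun h => not_forall_not_isOpen_DvNode.{u} fun X e => ((h X).1 e).2

/-- **F-0274: the universal closure of the two-place predicate `DPSCData.Adjacent` is REFUTED** (two
vertex labels to which no common node abuts) — `Adjacent` is VOCABULARY (Prop 1.3 (iv): "we shall
say that two vertices `v, v'` of `𝔾` are adjacent if there exists a node `e` that abuts to `v, v'`"),
not a statement; see `exists_adjacent` for its satisfiability. [cite: MochizukiAbsTopII2013, Prop 1.3 (iv) p.12] -/
theorem not_forall_adjacent : ¬ ∀ (X : DPSCData.{u}) (v v' : X.Vert), X.Adjacent v v' := by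
  intro h
  obtain ⟨X, -, ⟨v, v', -, hnadj, -⟩, -⟩ := exists_countermodel.{u}
  exact hnadj (h X v v')

/-- **F-0274: `DPSCData.Adjacent` is satisfiable** (a node abutting to `v, v'` makes them adjacent).
[cite: MochizukiAbsTopII2013, Prop 1.3 (iv) p.12] -/
theorem exists_adjacent : ∃ (X : DPSCData.{u}) (v v' : X.Vert), X.Adjacent v v' := by
  obtain ⟨X, -, -, -, -, ⟨v, v', h⟩⟩ := exists_countermodel.{u}
  exact ⟨X, v, v', h⟩

/-! ## A model: the predicates are consistent -/

/-- The good conclusions at ANY datum of the model's shape: `Π_𝔾 = 1`, `Π_I = Π_H`, all `Π_v = 1`,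
at most one vertex, no nodes, no cusps. [cite: MochizukiAbsTopII2013, Prop 1.3 (iii) p.11] -/
private theorem model_of (hG : X.PiG = ⊥) (hI : X.PiI = ⊤) (hv : ∀ v : X.Vert, X.vertSub v = ⊥)
    (hV : Subsingleton X.Vert) (hN : IsEmpty X.Node) (hC : IsEmpty X.Cusp) :
    X.Prop13iii ∧ X.Prop13iv ∧ X.Prop13iv' ∧ X.Prop13ix ∧ ∀ v v' : X.Vert, ¬ X.Adjacent v v' := by
  have hIv : ∀ v : X.Vert, X.Iv v = ⊤ := fun v => (X.Iv_eq_PiI_of_vertSub_eq_bot (hv v)).trans hI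
  refine ⟨fun v => ?_, ⟨fun v v' _ _ => Or.inl (Subsingleton.elim v v'),
    fun v v' _ _ => Subsingleton.elim v v'⟩, ⟨fun v v' _ _ _ => Or.inl (Subsingleton.elim v v'),
    fun v v' _ _ _ => Subsingleton.elim v v'⟩, ⟨fun e => isEmptyElim e, fun e => isEmptyElim e⟩,
    fun v v' ⟨e, _⟩ => isEmptyElim e⟩
  rw [hIv, hG, hI, inf_bot_eq, sup_bot_eq]
  exact ⟨rfl, rfl⟩

/-- **Model (WITNESS DATA).** The DPSC datum `Π_H = Π_I = ℤ/2` (discrete), `Π_𝔾 = 1`, one vertex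
with `Π_v = 1`, no nodes, no cusps ("a smooth proper curve with a single component over a log point
with inertia `I = ℤ/2`": `I_v = Z_{Π_I}(Π_v) = Π_I ⥲ I`) SATISFIES `Prop13iii`, `Prop13iv`,
`Prop13iv'` and — vacuously, having no edges — `Prop13ix`, while no two vertices are adjacent.  So
the typed predicates are consistent and the refutations above locate exactly the missing geometric
inputs. [cite: MochizukiAbsTopII2013, Prop 1.3 (iii) p.11] -/
theorem exists_model : ∃ X : DPSCData.{u},
    Nonempty X.Vert ∧ X.Prop13iii ∧ X.Prop13iv ∧ X.Prop13iv' ∧ X.Prop13ix ∧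
      ∀ v v' : X.Vert, ¬ X.Adjacent v v' := by
  haveI := discreteTopology_witnessGrp.{u}
  exact ⟨_, ⟨PUnit.unit⟩, model_of
    { PiH := ProfiniteGrp.ofFiniteGrp (FiniteGrp.of (ULift.{u} (Multiplicative (ZMod 2))))
      PiG := ⊥
      normal_PiG := inferInstance
      isClosed_PiG := isClosed_discrete _
      PiI := ⊤
      PiG_le_PiI := bot_le
      normal_PiI := inferInstance
      Vert := PUnit.{u + 1}
      Node := PEmpty.{u + 1}
      Cusp := PEmpty.{u + 1}
      vertSub := fun _ => ⊥
      vertSub_le := fun _ => le_rfl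
      nodeSub := fun e => e.elim
      nodeSub_le := fun e => e.elim
      cuspSub := fun e => e.elim
      cuspSub_le := fun e => e.elim
      nodeAbuts := fun e _ => e.elim
      cuspVert := fun e => e.elim }
    rfl rfl (fun _ => rfl) inferInstance inferInstance inferInstance⟩

/-- `Prop13iii ∧ Prop13iv ∧ Prop13ix` is SATISFIABLE (corollary of `exists_model`): the universal
closures are refuted above, the universal closure of the negation here — genuine schemata, to be
consumed at named instances only. [cite: MochizukiAbsTopII2013, Prop 1.3 (iii) p.11] -/
theorem not_forall_not_prop13iii_and : ¬ ∀ X : DPSCData.{u},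
    ¬ (X.Prop13iii ∧ X.Prop13iv ∧ X.Prop13ix) := by
  intro h
  obtain ⟨X, -, h3, h4, -, h9, -⟩ := exists_model.{u}
  exact h X ⟨h3, h4, h9⟩

end DPSCData

end Literature.AnabelianGeometry.AbsoluteAnabelian
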